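import Summits.AnomalousDissipation.AnomalousDissipation.Theses.QuarticLadder
import Summits.AnomalousDissipation.AnomalousDissipation.Theorems.UniformResolution.Negative.ResolutionCriterion
import Summits.AnomalousDissipation.AnomalousDissipation.Theorems.UniformResolution.Negative.Shape
import Summits.AnomalousDissipation.AnomalousDissipation.Theorems.MomentParityUniformResolutionSuperlinear
import Summits.AnomalousDissipation.AnomalousDissipation.Theorems.MomentParityUniformResolutionStubClosure
import Summits.AnomalousDissipation.AnomalousDissipation.Theorems.MomentParityUniformResolutionNecessity

/-!
# Strategist census sketch for crux `UniformResolution` (stmt-AnomalousDissipation-14330)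

Typed forms of the four census headings (STRATEGY-CENSUS.md). Nothing here is a route item or a
registered stub; every `def` is a SIGNATURE used in the census, and the theorems are the cheap
implications that locate each signature relative to the crux and to the live line `Sketch`
(stubs `stub_weightedH2`, `stub_loudUI`).

* §Strengthen  `SuperlinearEnstrophyMoment` (S⁺₁, all invariant level laws in a ball, one superlinear moment),
               `AllInvariantUI` (S⁺₂); `loudUI_conclusion_of_superlinear` : S⁺₁ feeds `stub_loudUI` verbatim.
* §Transfer    `NoDissipationDefect` (the 3-D analogue of the tree's 2-D `energy_eq_holds`, in level-law
               currency: truncated dissipations converge to the full dissipation uniformly along the family),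
               `FourthMomentL4` (statistical Lions–Shinbrot currency of card galerkin-khm-defect-flux).
* §Decomposition `LowModeLoudness` (Sub₁: the dissipation floor is attained on a fixed band, N-frequently —
               the only thing the realisation step downstream consumes) and `lowModeLoudness_of_uniformResolution`
               (UR ⇒ Sub₁, so Sub₁ is a genuine weakening); Sub₂ = "resolve above the floor" is the
               crux again in kind (census).
* §Negation    `LeakingLoudFamily` (the typed counterexample shape) and `leaking_needs_loud`
               (a leaking family is in particular a loud family: the d-wise Galerkin-ensemble zeroth law for
               that force — the antecedent side, summit-type).
-/

noncomputable section

set_option linter.dupNamespace false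

namespace Summit.AnomalousDissipation.AnomalousDissipation.Cruxes.UniformResolution.Strategist

open MeasureTheory Filter Topology
open scoped ENNReal
open Literature.Analysis.FunctionSpaces Literature.Analysis.FluidPDE
open Summit.AnomalousDissipation.AnomalousDissipation.Theorems.QuarticGate.Negative
open Summit.AnomalousDissipation.AnomalousDissipation.Theorems.UniformResolution.Negative
open Summit.AnomalousDissipation.AnomalousDissipation.Theorems.CubicParityLoud.Negative (L2T3)

/-- A loud Galerkin-invariant level-`N` law in the ball of radius `R` (the antecedent's measure after the
landed closure `stub_closure`: polynomially stationary at EVERY order). -/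
def IsLoudInvariantLaw (f : UnitAddTorus (Fin 3) → EuclideanSpace ℝ (Fin 3)) (ν : ℝ) (N : ℕ) (R E ε : ℝ)
    (μ : Measure (Torus.energySpace (Fin 3))) : Prop :=
  IsProbabilityMeasure μ ∧ (∀ᵐ u ∂μ, IsLevel N u) ∧ (∀ᵐ u ∂μ, ‖u‖ ≤ R) ∧
    (∀ d : ℕ, IsPolyStationary ν f N d μ) ∧ Torus.ensembleEnergy μ ≤ E ∧ ε ≤ Torus.ensembleDissipation ν μ

/-! ## §Strengthen -/

/-- **S⁺₁ `SuperlinearEnstrophyMoment`.** At fixed `ν > 0`, smooth `f` and radius `R`: ONE superlinear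
`Φ` and ONE finite `C` with `∫ Φ(‖∇u‖²) dμ ≤ C` for EVERY level `N` and EVERY level-`N` probability law in
the ball that is polynomially stationary at every order (all invariant laws, no loudness, no selection).
This is the `N`-uniform beyond-energy-class a priori estimate for 3-D Galerkin NS; by the landed
`loudUI_of_superlinear_moment` it discharges `stub_loudUI` with unchanged budgets. OPEN (no such Φ is known;
the FGT ladder stops at Φ(z) = z). -/
def SuperlinearEnstrophyMoment : Prop :=
  ∀ (f : UnitAddTorus (Fin 3) → EuclideanSpace ℝ (Fin 3)), Torus.IsSmooth f → ∀ (ν : ℝ), 0 < ν → ∀ R : ℝ,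
    ∃ (Φ : ℝ≥0∞ → ℝ≥0∞) (C : ℝ≥0∞), (∀ c : ℝ≥0∞, c ≠ ⊤ → ∃ L : ℝ≥0∞, L ≠ ⊤ ∧ ∀ z, L < z → c * z ≤ Φ z) ∧
      C ≠ ⊤ ∧ ∀ (N : ℕ) (μ : Measure (Torus.energySpace (Fin 3))), IsProbabilityMeasure μ →
        (∀ᵐ u ∂μ, IsLevel N u) → (∀ᵐ u ∂μ, ‖u‖ ≤ R) → (∀ d : ℕ, IsPolyStationary ν f N d μ) →
          ∫⁻ u, Φ (Torus.eGradNormSq (u.1 : UnitAddTorus (Fin 3) → EuclideanSpace ℝ (Fin 3))) ∂μ ≤ C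

/-- **S⁺₂ `AllInvariantUI`.** At fixed `ν > 0`, smooth `f`, radius `R`: the family of ALL level laws in the
ball that are polynomially stationary at every order (any level) has uniformly integrable enstrophy.
S⁺₁ ⇒ S⁺₂ (de la Vallée-Poussin) and S⁺₂ ⇒ the crux (criterion + FGT, landed); S⁺₂ ⟺ mean energy EQUALITY for
every Galerkin-limit stationary statistical solution in the ball (census §Transfer). OPEN. -/
def AllInvariantUI : Prop :=
  ∀ (f : UnitAddTorus (Fin 3) → EuclideanSpace ℝ (Fin 3)), Torus.IsSmooth f → ∀ (ν : ℝ), 0 < ν → ∀ R : ℝ,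
    UniformlyIntegrableEnstrophy {μ | IsProbabilityMeasure μ ∧ ∃ N : ℕ,
      (∀ᵐ u ∂μ, IsLevel N u) ∧ (∀ᵐ u ∂μ, ‖u‖ ≤ R) ∧ ∀ d : ℕ, IsPolyStationary ν f N d μ}

/-- S⁺₁ feeds the live line verbatim: under `SuperlinearEnstrophyMoment`, loud invariant level laws
(`N`-frequently, one ball per `j`) give the conclusion of `stub_loudUI` with the SAME budgets — by the landed
`loudUI_of_superlinear_moment`. (So S⁺₁ is a genuine strengthening of the bet, not a costume.) -/
theorem loudUI_conclusion_of_superlinear (hS : SuperlinearEnstrophyMoment)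
    (f : UnitAddTorus (Fin 3) → EuclideanSpace ℝ (Fin 3)) (hfs : Torus.IsSmooth f) (ν : ℕ → ℝ) (E ε : ℝ)
    (hν : ∀ j, 0 < ν j)
    (hloud : ∀ j : ℕ, ∃ R : ℝ, ∃ᶠ N in atTop, ∃ μ : Measure (Torus.energySpace (Fin 3)),
      IsLoudInvariantLaw f (ν j) N R E ε μ) :
    ∀ j : ℕ, ∃ (R : ℝ) (μs : ℕ → Measure (Torus.energySpace (Fin 3))),
      UniformlyIntegrableEnstrophy (Set.range μs) ∧
      ∃ᶠ N in atTop, IsProbabilityMeasure (μs N) ∧ (∀ᵐ u ∂(μs N), IsLevel N u) ∧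
        (∀ᵐ u ∂(μs N), ‖u‖ ≤ R) ∧ (∀ d : ℕ, IsPolyStationary (ν j) f N d (μs N)) ∧
        Torus.ensembleEnergy (μs N) ≤ E ∧ ε ≤ Torus.ensembleDissipation (ν j) (μs N) := by
  refine Theorems.MomentParityUniformResolution.loudUI_of_superlinear_moment f ν E ε fun j => ?_
  obtain ⟨R, hfreq⟩ := hloud j
  obtain ⟨Φ, C, hΦ, hC, hall⟩ := hS f hfs (ν j) (hν j) R
  refine ⟨R, Φ, C, hΦ, hC, hfreq.mono ?_⟩
  rintro N ⟨μ, hp, hl, hb, hst, hE, hD⟩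
  exact ⟨μ, hp, hl, hb, hst, hE, hD, hall N μ hp hl hb hst⟩

/-! ## §Transfer -/

/-- **T₁ `NoDissipationDefect f ν E ε`** — the 3-D analogue, in level-law currency, of the tree's 2-D theorem
`Torus.IsStationaryStatisticalSolution.energy_eq_holds`: along SOME sequence of loud invariant level laws
(levels `Ns i → ∞`, one ball) the band dissipations `ν∫‖∇P_K u‖²` converge, for each `K`, to numbers `e K`
whose limit is the limit `D` of the full dissipations — no dissipation is lost to `|k| → ∞`. Equivalent
to the crux's conclusion at this `ν` for that family (diagonal argument; necessity is the landed
`resolved_implies_uniformlyIntegrable` + weak continuity of band enstrophies). In 2-D the analogue holds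
because the enstrophy balance closes (`E|Au|² ≤ |f|²/ν²` uniformly in `N`); in 3-D the step that breaks is
the domination of the inertial remainder `∫(u⊗u):∇P_m u` (2-D: `≤ C|u|‖∇u‖²`, integrable under (1.29);
3-D: `≲ |u|^{1/2}‖∇u‖^{5/2}`, not integrable under any known `N`-uniform bound). -/
def NoDissipationDefect (f : UnitAddTorus (Fin 3) → EuclideanSpace ℝ (Fin 3)) (ν E ε : ℝ) : Prop :=
  ∃ (R D : ℝ) (Ns : ℕ → ℕ) (μs : ℕ → Measure (Torus.energySpace (Fin 3))) (e : ℕ → ℝ),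
    StrictMono Ns ∧ (∀ i, IsLoudInvariantLaw f ν (Ns i) R E ε (μs i)) ∧
    Tendsto (fun i => Torus.ensembleDissipation ν (μs i)) atTop (𝓝 D) ∧
    (∀ K : ℕ, Tendsto (fun i => ν * (∫⁻ u, Torus.eGradNormSq (Torus.fourierTruncate K
        (u.1 : UnitAddTorus (Fin 3) → EuclideanSpace ℝ (Fin 3))) ∂(μs i)).toReal) atTop (𝓝 (e K))) ∧
    Tendsto e atTop (𝓝 D)

/-- **T₂ `FourthMomentL4 f ν E ε`** — the statistical Lions–Shinbrot currency (card galerkin-khm-defect-flux):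
some loud invariant family, `N`-frequently, with an `N`-uniform fourth moment of the `L⁴(T³)` norm. Implies
`NoDissipationDefect` (commutator estimate), but needs `E[‖∇u‖³]`-type control by 3-D interpolation
(`‖u‖⁴_{L⁴} ≤ C|u|‖∇u‖³`) — strictly harder than uniform integrability of `‖∇u‖²`. -/
def FourthMomentL4 (f : UnitAddTorus (Fin 3) → EuclideanSpace ℝ (Fin 3)) (ν E ε : ℝ) : Prop :=
  ∃ (R : ℝ) (C : ℝ≥0∞), C ≠ ⊤ ∧ ∃ᶠ N in atTop, ∃ μ : Measure (Torus.energySpace (Fin 3)),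
    IsLoudInvariantLaw f ν N R E ε μ ∧
    ∫⁻ u, eLpNorm (u.1 : UnitAddTorus (Fin 3) → EuclideanSpace ℝ (Fin 3)) 4 volume ^ 4 ∂μ ≤ C

/-! ## §Decomposition -/

/-- **Sub₁ `LowModeLoudness`** (d-wise shape of the crux): under the crux's antecedent, budgets `(E′, ε′)`
uniform in `j` and, at every `j`, a radius `R`, ONE band `K` and infinitely many levels `N` such that for every
order `d` a loud `d`-stationary level-`N` law in the ball carries dissipation `≥ ε′` ON THE BAND `|k| ≤ K`.
This (and not the `κ`-schedule) is what the realisation step consumes: band enstrophy is weakly continuous, so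
the floor survives `N → ∞`. It is implied by the crux (`lowModeLoudness_of_uniformResolution`) and allows
a partial leak above the band — a genuine weakening; but it is the same wall in kind (a `ν`-uniform positive
fraction of the input must be viscously dissipated in the Galerkin limit). -/
def LowModeLoudness : Prop :=
  ∀ f : UnitAddTorus (Fin 3) → EuclideanSpace ℝ (Fin 3), Torus.IsSmooth f → Torus.IsDivFree f →
    Torus.HasZeroMean f → ∀ (ν : ℕ → ℝ) (E ε : ℝ), (∀ j, 0 < ν j) → Tendsto ν atTop (𝓝 0) → 0 < ε →
    (∀ j : ℕ, IsLoudFamilyAt f (ν j) E ε) →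
    ∃ E' ε' : ℝ, 0 < ε' ∧ ∀ j : ℕ, ∃ (R : ℝ) (K : ℕ), ∃ᶠ N in atTop, ∀ d : ℕ,
      ∃ μ : Measure (Torus.energySpace (Fin 3)), IsProbabilityMeasure μ ∧ (∀ᵐ u ∂μ, IsLevel N u) ∧
        (∀ᵐ u ∂μ, ‖u‖ ≤ R) ∧ IsPolyStationary (ν j) f N d μ ∧ Torus.ensembleEnergy μ ≤ E' ∧
        ε' ≤ ν j * (∫⁻ u, Torus.eGradNormSq (Torus.fourierTruncate K
          (u.1 : UnitAddTorus (Fin 3) → EuclideanSpace ℝ (Fin 3))) ∂μ).toReal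

/-- **Sub₂ `ResolutionAboveTheFloor`**: from band-loud families (Sub₁'s conclusion at one `ν`) to resolved loud
families (the crux's conclusion at that `ν`), budgets degradable. This is the crux again in kind: the band
floor says nothing about the enstrophy ABOVE the band, which is where the schedule `κ` lives. -/
def ResolutionAboveTheFloor : Prop :=
  ∀ f : UnitAddTorus (Fin 3) → EuclideanSpace ℝ (Fin 3), Torus.IsSmooth f → ∀ (ν E ε : ℝ), 0 < ν → 0 < ε →
    (∃ (R : ℝ) (K : ℕ), ∃ᶠ N in atTop, ∀ d : ℕ, ∃ μ : Measure (Torus.energySpace (Fin 3)),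
      IsProbabilityMeasure μ ∧ (∀ᵐ u ∂μ, IsLevel N u) ∧ (∀ᵐ u ∂μ, ‖u‖ ≤ R) ∧ IsPolyStationary ν f N d μ ∧
        Torus.ensembleEnergy μ ≤ E ∧ ε ≤ ν * (∫⁻ u, Torus.eGradNormSq (Torus.fourierTruncate K
          (u.1 : UnitAddTorus (Fin 3) → EuclideanSpace ℝ (Fin 3))) ∂μ).toReal) →
    ∃ E' ε' : ℝ, 0 < ε' ∧ IsResolvedLoudFamilyAt f ν E' ε'

/-- Band enstrophy is at most total enstrophy (spectral, termwise). -/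
theorem lintegral_eGradNormSq_fourierTruncate_le (K : ℕ) (μ : Measure (Torus.energySpace (Fin 3))) :
    ∫⁻ u, Torus.eGradNormSq (Torus.fourierTruncate K (u.1 : UnitAddTorus (Fin 3) → EuclideanSpace ℝ (Fin 3))) ∂μ
      ≤ ∫⁻ u, Torus.eGradNormSq (u.1 : UnitAddTorus (Fin 3) → EuclideanSpace ℝ (Fin 3)) ∂μ := by
  refine lintegral_mono fun u => ?_
  exact Literature.Analysis.FluidPDE.Torus.eGradNormSq_fourierTruncate_le
    ((Lp.memLp (u.1 : L2T3)).integrable one_le_two) K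

/-- **UR-conclusion ⇒ Sub₁ at one viscosity.** A `κ`-resolved law with dissipation `≥ ε` carries dissipation
`≥ ε − ν/(n+1)` on the band `|k| ≤ κ n`. -/
theorem band_floor_of_resolved {ν ε : ℝ} (hν : 0 ≤ ν) {κ : ℕ → ℕ} {μ : Measure (Torus.energySpace (Fin 3))}
    (hres : IsResolved κ μ) (hD : ε ≤ Torus.ensembleDissipation ν μ) (hε : 0 < ε) (n : ℕ) :
    ε - ν / ((n : ℝ) + 1) ≤ ν * (∫⁻ u, Torus.eGradNormSq (Torus.fourierTruncate (κ n)
      (u.1 : UnitAddTorus (Fin 3) → EuclideanSpace ℝ (Fin 3))) ∂μ).toReal := by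
  -- names
  set Z : ℝ≥0∞ := ∫⁻ u, Torus.eGradNormSq (u.1 : UnitAddTorus (Fin 3) → EuclideanSpace ℝ (Fin 3)) ∂μ with hZ
  set B : ℝ≥0∞ := ∫⁻ u, Torus.eGradNormSq (Torus.fourierTruncate (κ n)
      (u.1 : UnitAddTorus (Fin 3) → EuclideanSpace ℝ (Fin 3))) ∂μ with hB
  have hdiss : Torus.ensembleDissipation ν μ = ν * Z.toReal := rfl
  -- Z is finite (else the dissipation would be `ν * 0 < ε`)
  have hZtop : Z ≠ ⊤ := by
    intro htop
    rw [hdiss, htop, ENNReal.toReal_top, mul_zero] at hD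
    exact absurd (hε.trans_le hD) (lt_irrefl 0)
  have hBle : B ≤ Z := lintegral_eGradNormSq_fourierTruncate_le (κ n) μ
  have hBtop : B ≠ ⊤ := ne_top_of_le_ne_top hZtop hBle
  have hresn : Z ≤ B + ((n : ℝ≥0∞) + 1)⁻¹ := hres n
  have hn1 : ((n : ℝ≥0∞) + 1).toReal = (n : ℝ) + 1 := by
    rw [ENNReal.toReal_add (ENNReal.natCast_ne_top n) ENNReal.one_ne_top, ENNReal.toReal_natCast,
      ENNReal.toReal_one]
  have hinv : (((n : ℝ≥0∞) + 1)⁻¹).toReal = 1 / ((n : ℝ) + 1) := by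
    rw [ENNReal.toReal_inv, hn1, one_div]
  have hZreal : Z.toReal ≤ B.toReal + 1 / ((n : ℝ) + 1) := by
    have h1 : Z.toReal ≤ (B + ((n : ℝ≥0∞) + 1)⁻¹).toReal :=
      (ENNReal.toReal_le_toReal hZtop (by simp [hBtop])).2 hresn
    rw [ENNReal.toReal_add hBtop (by simp), hinv] at h1
    exact h1
  have hmul : ν * Z.toReal ≤ ν * B.toReal + ν / ((n : ℝ) + 1) := by
    have := mul_le_mul_of_nonneg_left hZreal hν
    calc ν * Z.toReal ≤ ν * (B.toReal + 1 / ((n : ℝ) + 1)) := this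
      _ = ν * B.toReal + ν / ((n : ℝ) + 1) := by ring
  rw [hdiss] at hD
  linarith

/-- **`UniformResolution` ⇒ `LowModeLoudness`** (so Sub₁ is a consequence of the crux: a genuine weakening,
usable as the realisation step's input). Choose `n` with `ν_j/(n+1) ≤ ε′/2` uniformly in `j` (the `ν_j` are
bounded since they tend to `0`). -/
theorem lowModeLoudness_of_uniformResolution
    (hUR : Summit.AnomalousDissipation.AnomalousDissipation.Theses.QuarticLadder.UniformResolution) :
    LowModeLoudness := by
  intro f hfs hfd hfz ν E ε hν hν0 hε hloud
  obtain ⟨E', ε', hε', hres⟩ := hUR f hfs hfd hfz ν E ε hν hν0 hε hloud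
  -- a uniform bound on ν
  obtain ⟨M, hM⟩ : ∃ M : ℝ, ∀ j, ν j ≤ M := by
    obtain ⟨M, hM⟩ := hν0.bddAbove_range
    exact ⟨M, fun j => hM ⟨j, rfl⟩⟩
  have hM0 : 0 < M := (hν 0).trans_le (hM 0)
  -- choose n with M/(n+1) ≤ ε'/2
  obtain ⟨n, hn⟩ := exists_nat_gt (2 * M / ε')
  have hn' : M / ((n : ℝ) + 1) ≤ ε' / 2 := by
    rw [div_le_iff₀ (by positivity)]
    have h1 : 2 * M / ε' < (n : ℝ) + 1 := hn.trans (lt_add_one _)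
    rw [div_lt_iff₀ hε'] at h1
    nlinarith
  refine ⟨E', ε' / 2, by positivity, fun j => ?_⟩
  obtain ⟨R, κ, hfreq⟩ := hres j
  refine ⟨R, κ n, hfreq.mono fun N hN d => ?_⟩
  obtain ⟨μ, hp, hl, hb, hresμ, hst, hE, hD⟩ := hN d
  refine ⟨μ, hp, hl, hb, hst, hE, ?_⟩
  have hfloor := band_floor_of_resolved (hν j).le hresμ hD hε' n
  have hνj : ν j / ((n : ℝ) + 1) ≤ ε' / 2 :=
    (div_le_div_of_nonneg_right (hM j) (by positivity)).trans hn'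
  linarith

/-! ## §Negation -/

/-- **`LeakingLoudFamily f ν E ε`** — the typed counterexample shape at one viscosity: a sequence of loud
invariant level laws (levels `→ ∞`, one ball) whose enstrophy tail beyond EVERY band `m` stays `≥ δ`
frequently along the sequence. NOTE: by `not_uniformResolution_iff` (landed) a disproof needs MORE — every
loud family of `f` at some `ν_j`, for every budget pair, must be unresolvable — and in particular it needs the
antecedent: a d-wise Galerkin-ensemble zeroth law for an explicit force (`dwise_of_not_uniformResolution`). -/
def LeakingLoudFamily (f : UnitAddTorus (Fin 3) → EuclideanSpace ℝ (Fin 3)) (ν E ε : ℝ) : Prop :=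
  ∃ (R : ℝ) (δ : ℝ≥0∞) (Ns : ℕ → ℕ) (μs : ℕ → Measure (Torus.energySpace (Fin 3))),
    0 < δ ∧ StrictMono Ns ∧ (∀ i, IsLoudInvariantLaw f ν (Ns i) R E ε (μs i)) ∧
    ∀ m : ℕ, ∃ᶠ i in atTop,
      δ ≤ ∫⁻ u, Torus.tailGradNormSq m (u.1 : UnitAddTorus (Fin 3) → EuclideanSpace ℝ (Fin 3)) ∂(μs i)

/-- A leaking loud family is in particular a loud family (the antecedent at that `ν`): constructing the
counterexample presupposes the Galerkin-ensemble zeroth law for that force at that viscosity. -/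
theorem leaking_needs_loud {f : UnitAddTorus (Fin 3) → EuclideanSpace ℝ (Fin 3)} {ν E ε : ℝ}
    (h : LeakingLoudFamily f ν E ε) : IsLoudFamilyAt f ν E ε := by
  obtain ⟨R, δ, Ns, μs, -, hmono, hloud, -⟩ := h
  refine ⟨R, ?_⟩
  have htend : Tendsto Ns atTop atTop := hmono.tendsto_atTop
  have hall : ∀ i, ∀ d : ℕ, ∃ μ : Measure (Torus.energySpace (Fin 3)),
      IsProbabilityMeasure μ ∧ (∀ᵐ u ∂μ, IsLevel (Ns i) u) ∧ (∀ᵐ u ∂μ, ‖u‖ ≤ R) ∧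
      IsPolyStationary ν f (Ns i) d μ ∧ Torus.ensembleEnergy μ ≤ E ∧ ε ≤ Torus.ensembleDissipation ν μ := by
    intro i d
    obtain ⟨hp, hl, hb, hst, hE, hD⟩ := hloud i
    exact ⟨μs i, hp, hl, hb, hst d, hE, hD⟩
  exact htend.frequently (Filter.Eventually.of_forall hall).frequently

end Summit.AnomalousDissipation.AnomalousDissipation.Cruxes.UniformResolution.Strategist

end
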